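import Summits.RiemannHypothesis.RiemannHypothesis.Theses.SpectralTrace
import Summits.RiemannHypothesis.RiemannHypothesis.Theorems.WindowTraceArch.Negative.ComplexSpectrum
import Literature.NumberTheory.LFunctions.WeilMellinBounds
import Literature.NumberTheory.LFunctions.GeneralizedRH
import Mathlib.Analysis.MellinTransform
import Mathlib.Analysis.SpecialFunctions.Integrals.Basic
import Mathlib.Analysis.Complex.LocallyUniformLimit
import HarnessLib

/-!
# `SpectralThesis` (stmt-RiemannHypothesis-0187): the prime side, I — Mellin analysis of the translates

Negative-lane analysis for the route target `X = SpectralThesis` of route SpectralTrace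
(refuter / cdisprove seat; supports stmt-RiemannHypothesis-0187). Tools for `BoundedTranslates.lean`
("bounded translates of the Weil functional force RH"):

* the test aimed at a zero `s₀`: `g(t) = e^{-(s₀-1/2)t} b(t)`, `ĝ(s₀) = ∫ b ≠ 0`
  (`isWeilTest_aimed`, `weilMellin_aimed_ne_zero`);
* the explicit formula for translates, `W(g(· - T)) = Σ_p e^{(ρ_p-1/2)T} ĝ(ρ_p)` (`hasSum_translate`,
  from the landed `hasSum_weilMellin_zeros`), read on `(0,1)` as `W(g(· + log t)) = Σ_p ĝ(ρ_p) t^{-(ρ_p-1/2)}`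
  (`hasSum_cpow`), continuity there (`continuousOn_translate_log`);
* the Mellin transform of `𝟙_{(0,1)} · W(g(· + log ·))`: holomorphic on `Re z > 0` when the translates
  are bounded (`differentiableOn_mellin_mellinSide`, via `mellin_differentiableAt_of_isBigO_rpow`), and
  equal to the partial-fraction series `Σ_p ĝ(ρ_p)/(z - (ρ_p - 1/2))` on `Re z > 1`
  (`mellin_mellinSide_eq_tsum`, termwise integration);
* pole bookkeeping: `summable_partialFraction`, the margin `min 1 η` on the half-strip (`margin_le`)
  and holomorphy of the tail (`differentiableOn_tail`).
-/

noncomputable section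

open Complex Set MeasureTheory Filter Asymptotics

namespace Summit.RiemannHypothesis.RiemannHypothesis.Theorems.SpectralThesis.Negative

open Literature.NumberTheory.LFunctions
open Summit.RiemannHypothesis.RiemannHypothesis.Theorems.WindowTraceArch.Negative

set_option quotPrecheck false in
/-- The zeros with multiplicity (index type of the explicit formula `hasSum_weilMellin_zeros`). -/
local notation "Zmult" =>
  (Σ ρ : ZetaZeros.riemannZetaNontrivialZeros, Fin (Int.toNat (riemannZetaZeroOrder (ρ : ℂ))))

set_option quotPrecheck false in
/-- The Mellin-side function `𝟙_{(0,1)} · (t ↦ W(g(· + log t)))`. -/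
local notation "mellinSide " g:max =>
  (Set.indicator (Ioo (0 : ℝ) 1) (fun t : ℝ => weilFunctional (weilTranslate g (-Real.log t))))

/-- The index of zeros with multiplicity is countable. [folklore] -/
theorem countable_zmult : Countable Zmult := by
  haveI : Countable ZetaZeros.riemannZetaNontrivialZeros :=
    riemannZetaNontrivialZeros_countable.to_subtype
  infer_instance
/-! ## The test function aimed at a zero -/

/-- The aimed test `g(t) = e^{-(s₀ - 1/2) t} b(t)` for a bump `b`. [folklore] -/
theorem isWeilTest_aimed (s₀ : ℂ) (b : ContDiffBump (0 : ℝ)) :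
    IsWeilTest fun t : ℝ => cexp (-(s₀ - 1 / 2) * t) * (b t : ℂ) := by
  refine ⟨ContDiff.mul ?_ (Complex.ofRealCLM.contDiff.comp b.contDiff), ?_⟩
  · exact Complex.contDiff_exp.comp (contDiff_const.mul Complex.ofRealCLM.contDiff)
  · exact (b.hasCompactSupport.comp_left Complex.ofReal_zero).mul_left

/-- Its transform at `s₀` is `∫ b > 0`. [folklore] -/
theorem weilMellin_aimed (s₀ : ℂ) (b : ContDiffBump (0 : ℝ)) :
    weilMellin (fun t : ℝ => cexp (-(s₀ - 1 / 2) * t) * (b t : ℂ)) s₀ = ((∫ t, b t : ℝ) : ℂ) := by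
  unfold weilMellin
  rw [← integral_complex_ofReal]
  refine integral_congr_ae (Eventually.of_forall fun t => ?_)
  simp only
  rw [mul_comm (cexp _) ((b t : ℂ)), mul_assoc, ← Complex.exp_add, show -(s₀ - 1 / 2) * (t : ℂ) +
    (s₀ - 1 / 2) * t = 0 by ring, Complex.exp_zero, mul_one]

/-- The aimed test does not vanish at `s₀` under the transform. [folklore] -/
theorem weilMellin_aimed_ne_zero (s₀ : ℂ) (b : ContDiffBump (0 : ℝ)) :
    weilMellin (fun t : ℝ => cexp (-(s₀ - 1 / 2) * t) * (b t : ℂ)) s₀ ≠ 0 := by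
  rw [weilMellin_aimed, Ne, Complex.ofReal_eq_zero]
  exact b.integral_pos.ne'

/-! ## The explicit formula for translates -/

variable {g : ℝ → ℂ}

/-- `W(g(· - T)) = Σ_p e^{(ρ_p - 1/2) T} ĝ(ρ_p)` (absolutely convergent). [folklore] -/
theorem hasSum_translate (hg : IsWeilTest g) (T : ℝ) :
    HasSum (fun p : Zmult => cexp (((p.1 : ℂ) - 1 / 2) * T) * weilMellin g (p.1 : ℂ))
      (weilFunctional (weilTranslate g T)) := by
  have h := hasSum_weilMellin_zeros (hg.weilTranslate T)
  simp only [weilMellin_weilTranslate] at h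
  exact h

/-- Absolute convergence of the zero side `Σ_p |ĝ(ρ_p)|`. [folklore] -/
theorem summable_norm_weilMellin_zeros (hg : IsWeilTest g) :
    Summable fun p : Zmult => ‖weilMellin g (p.1 : ℂ)‖ :=
  summable_norm_iff.2 (hasSum_weilMellin_zeros hg).summable

/-! ## The Mellin-side function `t ↦ W(g(· + log t))` on `(0,1)` -/

/-- On `(0, 1)`: `W(g(· - (-log t))) = Σ_p ĝ(ρ_p) t^{-(ρ_p - 1/2)}`. [folklore] -/
theorem hasSum_cpow (hg : IsWeilTest g) {t : ℝ} (ht : 0 < t) :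
    HasSum (fun p : Zmult => weilMellin g (p.1 : ℂ) * (t : ℂ) ^ (-((p.1 : ℂ) - 1 / 2)))
      (weilFunctional (weilTranslate g (-Real.log t))) := by
  have h := hasSum_translate hg (-Real.log t)
  convert h using 2
  rename_i p
  rw [mul_comm, cpow_def_of_ne_zero (by exact_mod_cast ht.ne'), ← Complex.ofReal_log ht.le]
  congr 1
  push_cast
  ring_nf

/-- Norm of the general term on `(0,1)`: `‖ĝ(ρ) t^{-(ρ-1/2)}‖ = ‖ĝ(ρ)‖ t^{1/2 - Re ρ} ≤ ‖ĝ(ρ)‖ ε^{-1/2}`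
for `ε ≤ t < 1`, `0 < ε`. [folklore] -/
theorem norm_term_le (g : ℝ → ℂ) (p : Zmult) {ε t : ℝ} (hε : 0 < ε) (hεt : ε ≤ t) (ht1 : t < 1) :
    ‖weilMellin g (p.1 : ℂ) * (t : ℂ) ^ (-((p.1 : ℂ) - 1 / 2))‖ ≤
      ‖weilMellin g (p.1 : ℂ)‖ * ε ^ (-(1 / 2 : ℝ)) := by
  have ht : 0 < t := hε.trans_le hεt
  rw [norm_mul, Complex.norm_cpow_eq_rpow_re_of_pos ht]
  refine mul_le_mul_of_nonneg_left ?_ (norm_nonneg _)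
  have hre : (-((p.1 : ℂ) - 1 / 2)).re = 1 / 2 - (p.1 : ℂ).re := by simp
  rw [hre]
  have h0 := ZetaZeros.riemannZetaNontrivialZeros.re_pos p.1.2
  have h1 := ZetaZeros.riemannZetaNontrivialZeros.re_lt_one p.1.2
  -- `t^{1/2 - β} ≤ t^{-1/2} ≤ ε^{-1/2}` since `t < 1` and `-1/2 ≤ 1/2 - β`
  calc t ^ (1 / 2 - (p.1 : ℂ).re) ≤ t ^ (-(1 / 2 : ℝ)) :=
        Real.rpow_le_rpow_of_exponent_ge ht ht1.le (by linarith)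
    _ ≤ ε ^ (-(1 / 2 : ℝ)) :=
        Real.rpow_le_rpow_of_nonpos hε hεt (by norm_num)

/-- Continuity of `t ↦ W(g(· + log t))` on `(0, 1)`. [folklore] -/
theorem continuousOn_translate_log (hg : IsWeilTest g) :
    ContinuousOn (fun t : ℝ => weilFunctional (weilTranslate g (-Real.log t))) (Ioo 0 1) := by
  intro t ht
  have hε : 0 < t / 2 := by linarith [ht.1]
  -- continuity on `Ioo (t/2) 1` of the series, by uniform convergence
  have hcont : ContinuousOn (fun u : ℝ => ∑' p : Zmult,
      weilMellin g (p.1 : ℂ) * (u : ℂ) ^ (-((p.1 : ℂ) - 1 / 2))) (Ioo (t / 2) 1) := by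
    refine continuousOn_tsum (fun p => ?_)
      ((summable_norm_weilMellin_zeros hg).mul_right ((t / 2) ^ (-(1 / 2 : ℝ))))
      (fun p u hu => norm_term_le g p hε hu.1.le hu.2)
    refine ContinuousOn.mul continuousOn_const ?_
    refine ContinuousOn.cpow Complex.continuous_ofReal.continuousOn continuousOn_const ?_
    intro u hu
    exact Complex.ofReal_mem_slitPlane.2 (hε.trans hu.1)
  have heq : EqOn (fun u : ℝ => weilFunctional (weilTranslate g (-Real.log u)))
      (fun u : ℝ => ∑' p : Zmult, weilMellin g (p.1 : ℂ) * (u : ℂ) ^ (-((p.1 : ℂ) - 1 / 2)))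
      (Ioo (t / 2) 1) :=
    fun u hu => ((hasSum_cpow hg (hε.trans hu.1)).tsum_eq).symm
  have hmem : Ioo (t / 2) 1 ∈ nhds t := Ioo_mem_nhds (by linarith [ht.1]) ht.2
  exact ((hcont.congr heq).continuousAt hmem).continuousWithinAt

/-! ## The Mellin transform: holomorphy on `Re z > 0` and termwise evaluation on `Re z > 1` -/

/-- The Mellin-side function inherits the bound on the translates. [folklore] -/
theorem norm_mellinSide_le {C : ℝ} (hB : ∀ T : ℝ, ‖weilFunctional (weilTranslate g T)‖ ≤ C) (t : ℝ) :
    ‖(mellinSide g) t‖ ≤ C :=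
  (norm_indicator_le_norm_self _ _).trans (hB _)

/-- The Mellin-side function is integrable (bounded, supported in `(0,1)`, continuous there). [folklore] -/
theorem integrable_mellinSide (hg : IsWeilTest g) {C : ℝ}
    (hB : ∀ T : ℝ, ‖weilFunctional (weilTranslate g T)‖ ≤ C) :
    Integrable (mellinSide g) := by
  refine (integrable_indicator_iff measurableSet_Ioo).2 ?_
  have hmeas : AEStronglyMeasurable (fun t : ℝ => weilFunctional (weilTranslate g (-Real.log t)))
      (volume.restrict (Ioo (0 : ℝ) 1)) :=
    (continuousOn_translate_log hg).aestronglyMeasurable measurableSet_Ioo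
  exact (integrable_const C).mono' hmeas (ae_of_all _ fun t => hB _)

/-- **The Laplace transform is holomorphic on `Re z > 0`** (as a Mellin transform of a bounded
function supported in `(0, 1)`). [folklore] -/
theorem differentiableOn_mellin_mellinSide (hg : IsWeilTest g) {C : ℝ}
    (hB : ∀ T : ℝ, ‖weilFunctional (weilTranslate g T)‖ ≤ C) :
    DifferentiableOn ℂ (mellin (mellinSide g)) {z : ℂ | 0 < z.re} := by
  intro z hz
  have hloc : LocallyIntegrableOn (mellinSide g) (Ioi 0) :=
    (integrable_mellinSide hg hB).locallyIntegrable.locallyIntegrableOn _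
  have htop : mellinSide g =O[atTop] fun x : ℝ => x ^ (-(z.re + 1)) := by
    refine IsBigO.of_bound 0 ?_
    filter_upwards [Ici_mem_atTop (1 : ℝ)] with x hx
    rw [Set.indicator_of_notMem (fun h => not_lt.2 (Set.mem_Ici.1 hx) h.2), norm_zero,
      zero_mul]
  have hbot : mellinSide g =O[nhdsWithin 0 (Ioi 0)] fun x : ℝ => x ^ (-(0 : ℝ)) := by
    refine IsBigO.of_bound C ?_
    filter_upwards [self_mem_nhdsWithin] with x hx
    rw [neg_zero, Real.rpow_zero, norm_one, mul_one]
    exact norm_mellinSide_le hB x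
  exact (mellin_differentiableAt_of_isBigO_rpow hloc htop (by simp) hbot hz).differentiableWithinAt

/-- `∫₀¹ t^{w-1} dt = 1/w` for `Re w > 0`. [folklore] -/
theorem integral_Ioo_cpow {w : ℂ} (hw : 0 < w.re) :
    ∫ t in Ioo (0 : ℝ) 1, (t : ℂ) ^ (w - 1) = 1 / w := by
  have hw0 : w ≠ 0 := fun h => by rw [h, Complex.zero_re] at hw; exact lt_irrefl _ hw
  rw [← integral_Ioc_eq_integral_Ioo, ← intervalIntegral.integral_of_le zero_le_one,
    integral_cpow (Or.inl (by simp; linarith))]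
  simp only [sub_add_cancel, Complex.ofReal_one, Complex.one_cpow, Complex.ofReal_zero,
    Complex.zero_cpow hw0, sub_zero]

/-- The real companion: `t ↦ t^{-1/2}` is integrable on `(0,1)` with integral `2`. [folklore] -/
theorem integral_Ioo_rpow_neg_half : ∫ t in Ioo (0 : ℝ) 1, t ^ (-(1 / 2 : ℝ)) = 2 := by
  rw [← integral_Ioc_eq_integral_Ioo, ← intervalIntegral.integral_of_le zero_le_one,
    integral_rpow (Or.inl (by norm_num))]
  norm_num

/-- `t^{-1/2}` is integrable on `(0,1)`. [folklore] -/
theorem integrableOn_rpow_neg_half : IntegrableOn (fun t : ℝ => t ^ (-(1 / 2 : ℝ))) (Ioo 0 1) := by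
  rw [← intervalIntegrable_iff_integrableOn_Ioo_of_le zero_le_one]
  exact intervalIntegral.intervalIntegrable_rpow' (by norm_num)

/-- Norm of the integrand term on `(0,1)` for `1 < Re z`: `≤ ‖ĝ(ρ)‖ t^{-1/2}`. [folklore] -/
theorem norm_integrand_le (g : ℝ → ℂ) {z : ℂ} (hz : 1 < z.re) (p : Zmult) {t : ℝ}
    (ht : t ∈ Ioo (0 : ℝ) 1) :
    ‖weilMellin g (p.1 : ℂ) * (t : ℂ) ^ (z - ((p.1 : ℂ) - 1 / 2) - 1)‖ ≤
      ‖weilMellin g (p.1 : ℂ)‖ * t ^ (-(1 / 2 : ℝ)) := by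
  rw [norm_mul, Complex.norm_cpow_eq_rpow_re_of_pos ht.1]
  refine mul_le_mul_of_nonneg_left ?_ (norm_nonneg _)
  have h1 := ZetaZeros.riemannZetaNontrivialZeros.re_lt_one p.1.2
  refine Real.rpow_le_rpow_of_exponent_ge ht.1 ht.2.le ?_
  simp only [sub_re, one_re, div_ofNat_re]
  linarith

/-- Each term of the series is integrable on `(0,1)` for `1 < Re z`. [folklore] -/
theorem integrable_term (g : ℝ → ℂ) {z : ℂ} (hz : 1 < z.re) (p : Zmult) :
    Integrable (fun t : ℝ => weilMellin g (p.1 : ℂ) * (t : ℂ) ^ (z - ((p.1 : ℂ) - 1 / 2) - 1))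
      (volume.restrict (Ioo (0 : ℝ) 1)) := by
  refine Integrable.mono' (integrableOn_rpow_neg_half.const_mul ‖weilMellin g (p.1 : ℂ)‖) ?_ ?_
  · refine ContinuousOn.aestronglyMeasurable ?_ measurableSet_Ioo
    refine ContinuousOn.mul continuousOn_const ?_
    refine ContinuousOn.cpow Complex.continuous_ofReal.continuousOn continuousOn_const ?_
    exact fun u hu => Complex.ofReal_mem_slitPlane.2 hu.1
  · exact (ae_restrict_iff' measurableSet_Ioo).2 (ae_of_all _ fun t ht => norm_integrand_le g hz p ht)

/-- **Termwise evaluation**: for `1 < Re z`,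
`mellin f z = Σ_p ĝ(ρ_p) / (z - (ρ_p - 1/2))`. [folklore] -/
theorem mellin_mellinSide_eq_tsum (hg : IsWeilTest g) {z : ℂ} (hz : 1 < z.re) :
    mellin (mellinSide g) z = ∑' p : Zmult, weilMellin g (p.1 : ℂ) / (z - ((p.1 : ℂ) - 1 / 2)) := by
  -- reduce to an integral over `(0,1)`
  have h1' : mellin (mellinSide g) z =
      ∫ t in Ioo (0 : ℝ) 1, (t : ℂ) ^ (z - 1) * weilFunctional (weilTranslate g (-Real.log t)) := by
    rw [mellin]
    have : ∀ t : ℝ, (t : ℂ) ^ (z - 1) • (mellinSide g) t =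
        (Ioo (0 : ℝ) 1).indicator (fun t => (t : ℂ) ^ (z - 1) *
          weilFunctional (weilTranslate g (-Real.log t))) t := by
      intro t
      rw [smul_eq_mul, Set.indicator_mul_right]
    simp_rw [this]
    rw [setIntegral_indicator measurableSet_Ioo, Set.inter_eq_right.2 Ioo_subset_Ioi_self]
  -- expand the integrand as a series
  have h2 : EqOn (fun t : ℝ => (t : ℂ) ^ (z - 1) * weilFunctional (weilTranslate g (-Real.log t)))
      (fun t : ℝ => ∑' p : Zmult, weilMellin g (p.1 : ℂ) * (t : ℂ) ^ (z - ((p.1 : ℂ) - 1 / 2) - 1))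
      (Ioo (0 : ℝ) 1) := by
    intro t ht
    have ht0 : (t : ℂ) ≠ 0 := by exact_mod_cast ht.1.ne'
    simp only
    rw [← (hasSum_cpow hg ht.1).tsum_eq, ← tsum_mul_left]
    refine tsum_congr fun p => ?_
    rw [mul_left_comm, ← Complex.cpow_add _ _ ht0]
    congr 2
    ring
  rw [h1', setIntegral_congr_fun measurableSet_Ioo h2]
  -- interchange sum and integral
  haveI := countable_zmult
  rw [← integral_tsum_of_summable_integral_norm (integrable_term g hz) ?_]
  · refine tsum_congr fun p => ?_
    rw [integral_const_mul, show z - ((p.1 : ℂ) - 1 / 2) - 1 = (z - ((p.1 : ℂ) - 1 / 2)) - 1 by ring,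
      integral_Ioo_cpow, mul_one_div]
    have h0 := ZetaZeros.riemannZetaNontrivialZeros.re_lt_one p.1.2
    simp only [sub_re, div_ofNat_re, one_re]
    linarith
  · refine Summable.of_nonneg_of_le (fun p => integral_nonneg fun _ => norm_nonneg _)
      (fun p => ?_) ((summable_norm_weilMellin_zeros hg).mul_right 2)
    calc ∫ t in Ioo (0 : ℝ) 1, ‖weilMellin g (p.1 : ℂ) * (t : ℂ) ^ (z - ((p.1 : ℂ) - 1 / 2) - 1)‖
        ≤ ∫ t in Ioo (0 : ℝ) 1, ‖weilMellin g (p.1 : ℂ)‖ * t ^ (-(1 / 2 : ℝ)) := by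
          refine setIntegral_mono_on (integrable_term g hz p).norm
            (integrableOn_rpow_neg_half.const_mul _) measurableSet_Ioo fun t ht => ?_
          exact norm_integrand_le g hz p ht
      _ = ‖weilMellin g (p.1 : ℂ)‖ * 2 := by
          rw [integral_const_mul, integral_Ioo_rpow_neg_half]

/-! ## Pole structure of the zero sum -/

/-- Summability of the partial fractions `ĝ(ρ_p)/(z - (ρ_p - 1/2))` for `1 < Re z`. [folklore] -/
theorem summable_partialFraction (hg : IsWeilTest g) {z : ℂ} (hz : 1 < z.re) :
    Summable fun p : Zmult => weilMellin g (p.1 : ℂ) / (z - ((p.1 : ℂ) - 1 / 2)) := by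
  refine Summable.of_norm_bounded ((summable_norm_weilMellin_zeros hg).div_const (1 / 2)) fun p => ?_
  rw [norm_div]
  have h1 := ZetaZeros.riemannZetaNontrivialZeros.re_lt_one p.1.2
  have hden : (1 / 2 : ℝ) ≤ ‖z - ((p.1 : ℂ) - 1 / 2)‖ := by
    refine le_trans ?_ (Complex.re_le_norm _)
    simp only [sub_re, div_ofNat_re, one_re]
    linarith
  exact div_le_div_of_nonneg_left (norm_nonneg _) one_half_pos hden

/-- **The margin**: on `U = {η < Re z, |Im z - γ₀| < 1}` every pole `ρ_p - 1/2` of a zero OUTSIDE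
`S = {|Im ρ - γ₀| < 2, 1/2 < Re ρ}` stays at distance `≥ min 1 η`. [folklore] -/
theorem margin_le {η γ₀ : ℝ} {z : ℂ} (hz1 : η < z.re) (hz2 : |z.im - γ₀| < 1)
    (p : Zmult) (hp : ¬ (|(p.1 : ℂ).im - γ₀| < 2 ∧ 1 / 2 < (p.1 : ℂ).re)) :
    min 1 η ≤ ‖z - ((p.1 : ℂ) - 1 / 2)‖ := by
  rcases not_and_or.1 hp with h | h
  · -- far in the imaginary direction
    rw [not_lt] at h
    refine (min_le_left _ _).trans (le_trans ?_ (Complex.abs_im_le_norm _))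
    simp only [sub_im, div_ofNat_im, one_im, zero_div, sub_zero]
    have h1 : |z.im - γ₀| < 1 := hz2
    rw [abs_lt] at h1
    rcases le_abs.1 h with h2 | h2
    · exact le_abs.2 (Or.inr (by linarith [h1.2]))
    · exact le_abs.2 (Or.inl (by linarith [h1.1]))
  · -- pole in the closed left half-plane
    rw [not_lt] at h
    refine (min_le_right _ _).trans (le_trans ?_ (Complex.re_le_norm _))
    simp only [sub_re, div_ofNat_re, one_re]
    linarith

/-- Differentiability of the partial-fraction TAIL (poles outside `S`) on `U`. [folklore] -/
theorem differentiableOn_tail (hg : IsWeilTest g) {η γ₀ : ℝ} (hη : 0 < η) (E : Finset Zmult)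
    (hE : ∀ p : Zmult, p ∉ E → ¬ (|(p.1 : ℂ).im - γ₀| < 2 ∧ 1 / 2 < (p.1 : ℂ).re)) :
    DifferentiableOn ℂ (fun z => ∑' p : {p // p ∉ E},
      weilMellin g (p.1.1 : ℂ) / (z - ((p.1.1 : ℂ) - 1 / 2)))
      ({z : ℂ | η < z.re} ∩ ({z : ℂ | z.im < γ₀ + 1} ∩ {z : ℂ | γ₀ - 1 < z.im})) := by
  have hm : 0 < min 1 η := lt_min one_pos hη
  have hmem : ∀ z : ℂ, z ∈ ({z : ℂ | η < z.re} ∩ ({z : ℂ | z.im < γ₀ + 1} ∩ {z : ℂ | γ₀ - 1 < z.im})) →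
      η < z.re ∧ |z.im - γ₀| < 1 := by
    rintro z ⟨h1, h2, h3⟩
    have h1' : η < z.re := h1
    have h2' : z.im < γ₀ + 1 := h2
    have h3' : γ₀ - 1 < z.im := h3
    exact ⟨h1', abs_lt.2 ⟨by linarith, by linarith⟩⟩
  refine differentiableOn_tsum_of_summable_norm
    (u := fun p : {p // p ∉ E} => ‖weilMellin g (p.1.1 : ℂ)‖ / min 1 η)
    (((summable_norm_weilMellin_zeros hg).subtype _).div_const _) (fun p => ?_) ?_ (fun p z hz => ?_)
  · refine DifferentiableOn.div (differentiableOn_const _)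
      (differentiableOn_id.sub (differentiableOn_const _)) fun z hz h0 => ?_
    have h := margin_le (hmem z hz).1 (hmem z hz).2 p.1 (hE p.1 p.2)
    rw [h0, norm_zero] at h
    exact not_lt.2 h hm
  · exact (isOpen_lt continuous_const Complex.continuous_re).inter
      ((isOpen_lt Complex.continuous_im continuous_const).inter
        (isOpen_lt continuous_const Complex.continuous_im))
  · rw [norm_div]
    exact div_le_div_of_nonneg_left (norm_nonneg _) hm
      (margin_le (hmem z hz).1 (hmem z hz).2 p.1 (hE p.1 p.2))

end Summit.RiemannHypothesis.RiemannHypothesis.Theorems.SpectralThesis.Negative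

end
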